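import Summits.ResolutionOfSingularities.ResolutionOfSingularities.Theorems.ProximityCutAxis
import Summits.ResolutionOfSingularities.ResolutionOfSingularities.Theorems.CornerTowerDynamicsTwo
import Summits.ResolutionOfSingularities.ResolutionOfSingularities.Theorems.CornerTowerDynamicsThree
import HarnessLib

/-!
# ProximityCutCorner — THE CORNER-HUGGING LAW `NoCornerHuggingTails` PROVED IN LEAN (lens §6, E-model)
(lens-3 g12 node «ProximityCut» rev 3a (sha256 3a2d1668… = rev 3 e1d6297007058045 + lint fix :1743);
CRITIC-LEDGER rows 79 / 83 / 84 (CLEARED, CLEARED-REV, CLEARED-REV3))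

[WRITER NOTE (decomp-res writer g5).  Lens §6 module docstring (:830–:846) and `section Corner` (:848–:1259) VERBATIM,
minus the pure-integer two-letter dynamics `dyn_exit` / `dyn_absorb` / `dyn_eventually` (:986–:1086) and `fin3_pair`
(:930–:935), which are the landed-separately `CornerTowerDynamicsTwo` / `CornerTowerDynamicsThree` (namespace
`CornerTowerDynamics`, opened).  Content: off-chart defects `offDeg`, `no_doubly_thin` (descent), lineages `desc` /
`exists_ancestor`, `lineage_eventually_fat`, the endgame `false_of_fat` (top ideal ≤ ker of the axis map), the theorem
`no_two_chart_origin_tail`, the piece `NoCornerHuggingTails` with `noCornerHuggingTails_holds` / `_deep` [NECESSARY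
sub-piece of 31770 · STRICTLY WEAKER · DECIDED — PROVED port-free; = lens-5's earlier and more general
`LassoCut.no_twoChart_corner_tail` (credit row 82: lens-5 holds, lens-3 co-credit)].  0 sorry; support definitions
`offDeg`, `desc`; Prop piece `NoCornerHuggingTails`.] (Sources: Hauser2010 Lecture IX;
BierstoneGrigorievMilmanWlodarczyk2011, §3.)
-/

open MvPolynomial
open Literature.AlgebraicGeometry.Resolution
open Literature.AlgebraicGeometry.Resolution.Hauser2010
open Literature.AlgebraicGeometry.Resolution.PointBlowup
open Summit.ResolutionOfSingularities.ResolutionOfSingularities.Theorems.TightDefectClasses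
open Summit.ResolutionOfSingularities.ResolutionOfSingularities.Theorems.TightDefectStrongWalks
open Summit.ResolutionOfSingularities.ResolutionOfSingularities.Theorems.ItineraryCutClasses
open Summit.ResolutionOfSingularities.ResolutionOfSingularities.Theorems.BoundaryLedger
open Summit.ResolutionOfSingularities.ResolutionOfSingularities.Theorems.CornerTowerDynamics

namespace Summit.ResolutionOfSingularities.ResolutionOfSingularities.Theorems.ProximityCut

/-! ## §6 THE CORNER-HUGGING LAW — PROVED IN LEAN (g12 addendum, after critic row 79)

No forced walk from a root sits, from some stage on, at the ORIGIN of charts that avoid one fixed coordinate `k`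
(`b_t = 0 ∧ j_t ≠ k` for `t ≥ N`; piece `NoCornerHuggingTails`, theorem `noCornerHuggingTails_holds`).  Geometrically
the walk hugs the old component `{u_k = 0}` through the CORNER points of the two freshest components; every chart
change on such a tail is a PROXIMITY REPEAT, so when both charts `i, i'` recur this is a PORT-FREE DECIDED PIECE INSIDE
THE RESIDUAL `NoRecurrentProximity(Deep)` (the first one); when one chart is eventually constant it is the axis law.
MECHANISM = EUCLID DYNAMICS OF THE OFF-CHART DEFECTS.  For a monomial `u^d` put `y_x := |d|_{off x} − q`; a step at
the origin of chart `j` keeps `y_j`, adds `y_j` to the two other `y_x` (`offDeg_chartExponent_of_ne`) and freezes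
`d_k`.  (i) DOUBLY THIN monomials (`y_i < 0 ∧ y_{i'} < 0`) lose total degree at every step and are never cleaned, so
they do not occur from stage `N` on (`no_doubly_thin`, descent as in §4); (ii) hence along the LINEAGE of a monomial
(`desc`; monomials are only transformed or deleted, `exists_parent`) the pair `(x, y) = (y_{i'}, y_i)` is never doubly
negative and follows `L : (x,y) ↦ (x+y, y)` (chart `i`) / `R : (x,y) ↦ (x, x+y)` (chart `i'`); with both letters
recurring this integer dynamics enters the absorbing quadrant `x, y ≥ 0` (`dyn_exit`: while `x < 0` one has `y > 0`
— a zero `y` would make the next `R`-step doubly negative — and `y − x` drops at every step); (iii) by finiteness of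
the support of `F_N` (pigeonhole, `Filter.eventually_all_finset`) some stage has ALL monomials fat off `i`, and the
§4 endgame (restriction to the `u_i`-axis kills the top-locus ideal; isolation) ends the walk (`false_of_fat`). -/

section Corner

variable {K : Type} [Field K] [DecidableEq K] {q : ℕ} {s₀ : State (Fin 3) K}

/-- `|d|` off the coordinate `x`.  DEFINITION (support). -/
noncomputable def offDeg (x : Fin 3) (d : Fin 3 →₀ ℕ) : ℕ := (Finsupp.erase x d).degree

/-- A step in chart `j` keeps the off-`j` degree. [folklore] -/
theorem offDeg_chartExponent_self (q : ℕ) (j : Fin 3) (d : Fin 3 →₀ ℕ) :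
    offDeg j (chartExponent q j d) = offDeg j d := by
  unfold offDeg
  rw [chartExponent_erase]

/-- … keeps the other exponents … [folklore] -/
theorem chartExponent_apply_ne (q : ℕ) {j i : Fin 3} (hij : i ≠ j) (d : Fin 3 →₀ ℕ) :
    chartExponent q j d i = d i := by
  have h := congrArg (fun c : Fin 3 →₀ ℕ => c i) (chartExponent_erase q j d)
  simp only [Finsupp.erase_ne hij] at h
  exact h

/-- … changes the total degree by `|d|_{off j} − q` … [folklore] -/
theorem degree_chartExponent_add (q : ℕ) (j : Fin 3) (d : Fin 3 →₀ ℕ) (hd : q ≤ d.degree) :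
    (chartExponent q j d).degree + q = offDeg j d + d.degree := by
  have h1 := degree_erase_add (chartExponent q j d) j
  rw [chartExponent_erase, chartExponent_self] at h1
  unfold offDeg
  omega

/-- … and adds `y_j` to `y_i` (`i ≠ j`): `|d'|_{off i} + q = |d|_{off i} + |d|_{off j}`. [folklore] -/
theorem offDeg_chartExponent_of_ne (q : ℕ) {j i : Fin 3} (hij : i ≠ j) (d : Fin 3 →₀ ℕ) (hd : q ≤ d.degree) :
    offDeg i (chartExponent q j d) + q = offDeg i d + offDeg j d := by
  have h1 := degree_erase_add (chartExponent q j d) i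
  have h2 := degree_chartExponent_add q j d hd
  have h3 := chartExponent_apply_ne q hij d
  have h4 := degree_erase_add d i
  unfold offDeg at *
  rw [h3] at h1
  omega

/-- An exponent is bounded by every off-degree not excluding it. [folklore] -/
theorem apply_le_offDeg {x y : Fin 3} (hxy : x ≠ y) (d : Fin 3 →₀ ℕ) : d x ≤ offDeg y d := by
  have h := Finsupp.le_degree x (Finsupp.erase y d)
  rwa [Finsupp.erase_ne hxy] at h

/-- Small non-zero exponents are not `q`-th powers. [folklore] -/
theorem not_isPthPowerExponent_of_lt {d : Fin 3 →₀ ℕ} (hsmall : ∀ x, d x < q) (hne : d ≠ 0) :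
    ¬ IsPthPowerExponent q d := by
  intro hP
  apply hne
  ext x
  by_cases hx : x ∈ d.support
  · exact Nat.eq_zero_of_dvd_of_lt (hP x hx) (hsmall x)
  · exact Finsupp.notMem_support_iff.mp hx

/-- At an origin step every monomial of the new state is the image of an old one (monomials are only transformed or
deleted). [folklore] -/
theorem exists_parent (W : ForcedWalk q s₀) (t : ℕ) (hb : W.b t = 0) {d' : Fin 3 →₀ ℕ}
    (hd' : d' ∈ (W.st (t + 1)).F.support) : ∃ d ∈ (W.st t).F.support, chartExponent q (W.j t) d = d' := by
  classical
  have h := mem_support_iff.mp hd'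
  rw [st_succ_F_axis W t rfl hb, coeff_deletePthPowers] at h
  split_ifs at h with hP
  · exact absurd rfl h
  · unfold chartTransform at h
    rw [coeff_sum] at h
    obtain ⟨d, hd, hne⟩ := Finset.exists_ne_zero_of_sum_ne_zero h
    refine ⟨d, hd, ?_⟩
    rw [coeff_monomial] at hne
    by_contra hcd
    exact hne (if_neg hcd)

/-- Persistence at an origin step: an old monomial whose image is not a `q`-th power survives with its coefficient.
[folklore] -/
theorem image_mem_support (hs : IsRoot q s₀) (W : ForcedWalk q s₀) (t : ℕ) {a : Fin 3} (hja : W.j t = a)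
    (hb : W.b t = 0) {d : Fin 3 →₀ ℕ} (hd : d ∈ (W.st t).F.support)
    (hnP : ¬ IsPthPowerExponent q (chartExponent q a d)) : chartExponent q a d ∈ (W.st (t + 1)).F.support := by
  classical
  have hall : ∀ d' ∈ (W.st t).F.support, q ≤ d'.degree := fun d' hd' => le_degree_of_mem_support hs W t hd'
  rw [mem_support_iff, st_succ_F_axis W t hja hb, coeff_deletePthPowers, if_neg hnP,
    coeff_chartTransform_chartExponent _ hall hd]
  exact mem_support_iff.mp hd

/-- **(i) NO DOUBLY THIN MONOMIALS (PROVED).**  On an origin tail avoiding `k`, no monomial of `F_t` (`t ≥ N`) is thin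
off both other coordinates: its image is again doubly thin, never a `q`-th power, and of smaller degree — descent.
[folklore] -/
theorem no_doubly_thin (hs : IsRoot q s₀) (W : ForcedWalk q s₀) {N : ℕ} {i i' k : Fin 3} (hii' : i ≠ i')
    (hcov : ∀ j, j ≠ k → j = i ∨ j = i') (hN : ∀ t, N ≤ t → W.b t = 0 ∧ W.j t ≠ k) :
    ∀ n t : ℕ, N ≤ t → ∀ d ∈ (W.st t).F.support, offDeg i d < q → offDeg i' d < q → d.degree ≤ n → False := by
  classical
  -- the symmetric step, for a chart `a` and the other coordinate `a'`
  have step : ∀ t, N ≤ t → ∀ {a a' : Fin 3}, a ≠ a' → W.j t = a → ∀ d ∈ (W.st t).F.support,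
      offDeg a d < q → offDeg a' d < q →
      chartExponent q a d ∈ (W.st (t + 1)).F.support ∧ offDeg a (chartExponent q a d) < q ∧
        offDeg a' (chartExponent q a d) < q ∧ (chartExponent q a d).degree < d.degree := by
    intro t ht a a' haa' hja d hd h1 h2
    have hdeg : q ≤ d.degree := le_degree_of_mem_support hs W t hd
    have hndvd : ¬ IsPthPowerExponent q d := not_isPthPowerExponent_of_mem_support hs W t hd
    have e1 : offDeg a (chartExponent q a d) = offDeg a d := offDeg_chartExponent_self q a d
    have e2 := offDeg_chartExponent_of_ne q (Ne.symm haa') d hdeg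
    have e3 := degree_chartExponent_add q a d hdeg
    have h1' : offDeg a (chartExponent q a d) < q := by omega
    have h2' : offDeg a' (chartExponent q a d) < q := by omega
    have hlt : (chartExponent q a d).degree < d.degree := by omega
    refine ⟨image_mem_support hs W t hja (hN t ht).1 hd ?_, h1', h2', hlt⟩
    -- the image is small in every coordinate and non-zero, hence not a `q`-th power
    refine not_isPthPowerExponent_of_lt (fun x => ?_) ?_
    · by_cases hx : x = a
      · rw [hx]; exact lt_of_le_of_lt (apply_le_offDeg haa' _) h2'
      · exact lt_of_le_of_lt (apply_le_offDeg hx _) h1'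
    · intro hc0
      have hα0 : Finsupp.erase a d = 0 := by rw [← chartExponent_erase q a d, hc0, Finsupp.erase_zero]
      have hsum := degree_erase_add d a
      have hdeg0 : (chartExponent q a d).degree = 0 := by rw [hc0, map_zero]
      have hαdeg : (Finsupp.erase a d).degree = 0 := by rw [hα0, map_zero]
      have hja' : d a = q := by unfold offDeg at e3; omega
      refine hndvd ?_
      rw [eq_single_of_erase_eq_zero hα0, hja']
      exact (isPthPowerExponent_single_iff (by omega)).mpr (dvd_refl q)
  intro n
  induction n with
  | zero =>
    intro t ht d hd h1 h2 hn
    have := le_degree_of_mem_support hs W t hd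
    omega
  | succ n ih =>
    intro t ht d hd h1 h2 hn
    rcases hcov (W.j t) (hN t ht).2 with hja | hja
    · obtain ⟨hmem, g1, g2, glt⟩ := step t ht hii' hja d hd h1 h2
      exact ih (t + 1) (by omega) _ hmem g1 g2 (by omega)
    · obtain ⟨hmem, g1, g2, glt⟩ := step t ht (Ne.symm hii') hja d hd h2 h1
      exact ih (t + 1) (by omega) _ hmem g2 g1 (by omega)
/-- The deterministic LINEAGE of an exponent from stage `N` (monomials are only transformed at origin steps).
DEFINITION (support). -/
noncomputable def desc (W : ForcedWalk q s₀) (N : ℕ) (d₀ : Fin 3 →₀ ℕ) : ℕ → (Fin 3 →₀ ℕ)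
  | 0 => d₀
  | n + 1 => chartExponent q (W.j (N + n)) (desc W N d₀ n)

/-- Every monomial of `F_{N+n}` descends from one of `F_N` through a lineage alive at all intermediate stages.
[folklore] -/
theorem exists_ancestor (W : ForcedWalk q s₀) {N : ℕ} (hN : ∀ t, N ≤ t → W.b t = 0) :
    ∀ n, ∀ d ∈ (W.st (N + n)).F.support, ∃ d₀ ∈ (W.st N).F.support,
      desc W N d₀ n = d ∧ ∀ m, m ≤ n → desc W N d₀ m ∈ (W.st (N + m)).F.support := by
  intro n
  induction n with
  | zero =>
    intro d hd
    refine ⟨d, hd, rfl, fun m hm => ?_⟩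
    obtain rfl : m = 0 := by omega
    exact hd
  | succ n ih =>
    intro d hd
    obtain ⟨d₁, hd₁, he⟩ := exists_parent W (N + n) (hN _ (by omega)) hd
    obtain ⟨d₀, hd₀, hdesc, halive⟩ := ih d₁ hd₁
    refine ⟨d₀, hd₀, ?_, fun m hm => ?_⟩
    · show chartExponent q (W.j (N + n)) (desc W N d₀ n) = d
      rw [hdesc, he]
    · rcases Nat.lt_or_ge m (n + 1) with hlt | hge
      · exact halive m (by omega)
      · obtain rfl : m = n + 1 := by omega
        show chartExponent q (W.j (N + n)) (desc W N d₀ n) ∈ _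
        rw [hdesc, he]
        exact hd

/-- **(ii′) LINEAGE FATTENING (PROVED).**  On an origin tail avoiding `k` with both charts `i, i'` recurring, an
always-alive lineage is eventually fat off `i` (Euclid dynamics of `(y_{i'}, y_i)`, fed by `no_doubly_thin`). [folklore] -/
theorem lineage_eventually_fat (hs : IsRoot q s₀) (W : ForcedWalk q s₀) {N : ℕ} {i i' k : Fin 3} (hii' : i ≠ i')
    (hcov : ∀ j, j ≠ k → j = i ∨ j = i') (hN : ∀ t, N ≤ t → W.b t = 0 ∧ W.j t ≠ k)
    (hLio : ∀ n, ∃ m, n ≤ m ∧ W.j (N + m) = i)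
    (hRio : ∀ n, ∃ m, n ≤ m ∧ W.j (N + m) = i') {d₀ : Fin 3 →₀ ℕ}
    (halive : ∀ n, desc W N d₀ n ∈ (W.st (N + n)).F.support) :
    ∃ n₀, ∀ n, n₀ ≤ n → q ≤ offDeg i (desc W N d₀ n) := by
  classical
  let x : ℕ → ℤ := fun n => (offDeg i' (desc W N d₀ n) : ℤ) - q
  let y : ℕ → ℤ := fun n => (offDeg i (desc W N d₀ n) : ℤ) - q
  have hdeg : ∀ n, q ≤ (desc W N d₀ n).degree := fun n => le_degree_of_mem_support hs W (N + n) (halive n)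
  have hL : ∀ n, W.j (N + n) = i → x (n + 1) = x n + y n ∧ y (n + 1) = y n := by
    intro n hn
    have e1 := offDeg_chartExponent_of_ne q (Ne.symm hii') (desc W N d₀ n) (hdeg n)
    have e2 := offDeg_chartExponent_self q i (desc W N d₀ n)
    have hd : desc W N d₀ (n + 1) = chartExponent q i (desc W N d₀ n) := by
      show chartExponent q (W.j (N + n)) (desc W N d₀ n) = _
      rw [hn]
    simp only [x, y, hd]
    constructor <;> omega
  have hR : ∀ n, ¬ W.j (N + n) = i → x (n + 1) = x n ∧ y (n + 1) = x n + y n := by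
    intro n hn
    have hn' : W.j (N + n) = i' := ((hcov _ (hN _ (by omega)).2).resolve_left hn)
    have e1 := offDeg_chartExponent_of_ne q hii' (desc W N d₀ n) (hdeg n)
    have e2 := offDeg_chartExponent_self q i' (desc W N d₀ n)
    have hd : desc W N d₀ (n + 1) = chartExponent q i' (desc W N d₀ n) := by
      show chartExponent q (W.j (N + n)) (desc W N d₀ n) = _
      rw [hn']
    simp only [x, y, hd]
    constructor <;> omega
  have hH : ∀ n, ¬ (x n < 0 ∧ y n < 0) := by
    intro n ⟨hx, hy⟩
    have hx' : offDeg i' (desc W N d₀ n) < q := by simp only [x] at hx; omega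
    have hy' : offDeg i (desc W N d₀ n) < q := by simp only [y] at hy; omega
    exact no_doubly_thin hs W hii' hcov hN _ (N + n) (by omega) _ (halive n) hy' hx' le_rfl
  have hRio' : ∀ n, ∃ m, n ≤ m ∧ ¬ W.j (N + m) = i := by
    intro n
    obtain ⟨m, hm, hjm⟩ := hRio n
    exact ⟨m, hm, by rw [hjm]; exact Ne.symm hii'⟩
  obtain ⟨n₀, hn₀⟩ := dyn_eventually x y (fun n => W.j (N + n) = i) hL hR hH hLio hRio'
  refine ⟨n₀, fun n hn => ?_⟩
  have := (hn₀ n hn).2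
  simp only [y] at this
  omega

/-- The §4 endgame for any direction `i` and stage `t`: a state all of whose monomials are fat off `i` is not
isolated (restriction to the `u_i`-axis kills the top-locus ideal). [folklore] -/
theorem false_of_fat (W : ForcedWalk q s₀) (t : ℕ) (i : Fin 3)
    (hfat : ∀ d ∈ (W.st t).F.support, q ≤ (Finsupp.erase i d).degree) : False := by
  classical
  obtain ⟨N₀, g, hg0, hg⟩ := W.isolated t
  have hker : topIdeal q (W.st t).F ≤ RingHom.ker (aeval (axisMap K i)).toRingHom := by
    unfold topIdeal
    rw [Ideal.span_le]
    rintro _ ⟨c, ⟨-, hc⟩, rfl⟩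
    rw [SetLike.mem_coe, RingHom.mem_ker]
    exact aeval_axisMap_hasseDeriv_eq_zero i _ hfat c hc
  have h0 := hker (hg i)
  rw [RingHom.mem_ker] at h0
  change aeval (axisMap K i) (g * X i ^ N₀) = 0 at h0
  rw [map_mul, map_pow, aeval_X] at h0
  have hX : axisMap K i i = X i := by unfold axisMap; rw [if_pos rfl]
  rw [hX] at h0
  have hg' : aeval (axisMap K i) g = 0 := (mul_eq_zero.mp h0).resolve_right (pow_ne_zero _ (X_ne_zero i))
  apply hg0
  rw [← constantCoeff_aeval_axisMap i g, hg', map_zero]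

/-- **(iii) TWO RECURRING CHARTS AT THE ORIGIN (PROVED)**: pigeonhole over the finite support of `F_N` + lineage
fattening ⇒ some stage is fat off `i` ⇒ `false_of_fat`. [folklore] -/
theorem no_two_chart_origin_tail (hs : IsRoot q s₀) (W : ForcedWalk q s₀) {N : ℕ} {i i' k : Fin 3} (hii' : i ≠ i')
    (hcov : ∀ j, j ≠ k → j = i ∨ j = i') (hN : ∀ t, N ≤ t → W.b t = 0 ∧ W.j t ≠ k)
    (hLio : ∀ n, ∃ m, n ≤ m ∧ W.j (N + m) = i)
    (hRio : ∀ n, ∃ m, n ≤ m ∧ W.j (N + m) = i') : False := by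
  classical
  let S := (W.st N).F.support
  let bad : (Fin 3 →₀ ℕ) → ℕ → Prop := fun d₀ n =>
    (∀ m, m ≤ n → desc W N d₀ m ∈ (W.st (N + m)).F.support) ∧ offDeg i (desc W N d₀ n) < q
  have hev : ∀ d₀ ∈ S, ∀ᶠ n in Filter.atTop, ¬ bad d₀ n := by
    intro d₀ _
    rw [Filter.eventually_atTop]
    by_cases halive : ∀ n, desc W N d₀ n ∈ (W.st (N + n)).F.support
    · obtain ⟨n₀, hn₀⟩ := lineage_eventually_fat hs W hii' hcov hN hLio hRio halive
      exact ⟨n₀, fun n hn hb => absurd (hn₀ n hn) (not_le.mpr hb.2)⟩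
    · push Not at halive
      obtain ⟨n₁, hn₁⟩ := halive
      exact ⟨n₁, fun n hn hb => hn₁ (hb.1 n₁ hn)⟩
  obtain ⟨T, hT⟩ := Filter.eventually_atTop.mp ((Filter.eventually_all_finset S).mpr hev)
  refine false_of_fat W (N + T) i fun d hd => ?_
  obtain ⟨d₀, hd₀, hdesc, halive⟩ := exists_ancestor W (fun t ht => (hN t ht).1) T d hd
  have hnb := hT T le_rfl d₀ hd₀
  by_contra hlt
  push Not at hlt
  exact hnb ⟨halive, by rw [hdesc]; exact hlt⟩

/-- PIECE · THE CORNER-HUGGING LAW · PROVED IN LEAN (`noCornerHuggingTails_holds`): no forced walk from a root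
sits, from some stage on, at the ORIGIN of charts avoiding one fixed coordinate `k` — the walk never hugs an old
component through corner points forever.  Contains the axis law (`j_t` constant); its two-recurring-charts half is
a decided piece INSIDE the proximity residual.  Statement port-free, all `e ≥ 1`, no shade hypothesis. -/
def NoCornerHuggingTails : Prop :=
  ∀ p : ℕ, p.Prime → ∀ e : ℕ, 1 ≤ e → ∀ (K : Type) [Field K] [CharP K p] [PerfectField K] [DecidableEq K]
    (s₀ : State (Fin 3) K), IsRoot (p ^ e) s₀ → ∀ W : ForcedWalk (p ^ e) s₀,
    ∀ (N : ℕ) (k : Fin 3), (∀ t, N ≤ t → W.b t = 0 ∧ W.j t ≠ k) → False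

/-- **THE CORNER-HUGGING LAW, PROVED.**  Either one chart is eventually constant (axis law, §4) or both charts off `k`
recur (`no_two_chart_origin_tail`). [folklore] -/
theorem noCornerHuggingTails_holds : NoCornerHuggingTails := by
  intro p hp e he K _ _ _ _ s₀ hs W N k hN
  classical
  obtain ⟨i, i', -, -, hii', hcov⟩ := fin3_pair k
  by_cases hax : ∃ (N₁ : ℕ) (j : Fin 3), ∀ t, N₁ ≤ t → W.j t = j
  · obtain ⟨N₁, j, hj⟩ := hax
    exact noAxisTails_holds p hp e he K s₀ hs W (max N N₁) j fun t ht =>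
      ⟨hj t (le_trans (le_max_right _ _) ht), (hN t (le_trans (le_max_left _ _) ht)).1⟩
  · push Not at hax
    -- both charts recur after `N`
    have hrec : ∀ {a a' : Fin 3}, a ≠ a' → (∀ j, j ≠ k → j = a ∨ j = a') →
        ∀ n, ∃ m, n ≤ m ∧ W.j (N + m) = a := by
      intro a a' haa' hcov' n
      by_contra hnone
      push Not at hnone
      obtain ⟨t, ht, hjt⟩ := hax (N + n) a'
      have hm := hnone (t - (N + n) + n) (by omega)
      have ht' : N + (t - (N + n) + n) = t := by omega
      rw [ht'] at hm
      rcases hcov' (W.j t) (hN t (by omega)).2 with h | h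
      · exact hm h
      · exact hjt h
    exact no_two_chart_origin_tail hs W hii' hcov hN (hrec hii' hcov)
      (hrec (Ne.symm hii') fun j hj => (hcov j hj).symm)

/-- The corner-hugging law on the deep defect column BY INSTANTIATION (a PROVED sub-piece of the blocker 31770 and,
for two recurring charts, of its proximity residual `NoRecurrentProximityDeep`). [folklore] -/
theorem noCornerHuggingTails_deep :
    ∀ p : ℕ, p.Prime → ∀ e : ℕ, 2 ≤ e → ∀ (K : Type) [Field K] [CharP K p] [PerfectField K] [DecidableEq K]
    (s₀ : State (Fin 3) K), IsRoot (p ^ e) s₀ → ∀ W : ForcedWalk (p ^ e) s₀, (∀ i, 1 ≤ (W.st i).shade) →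
    ∀ (N : ℕ) (k : Fin 3), (∀ t, N ≤ t → W.b t = 0 ∧ W.j t ≠ k) → False :=
  fun p hp e he K _ _ _ _ s₀ hs W _ N k hN => noCornerHuggingTails_holds p hp e (by omega) K s₀ hs W N k hN

end Corner

end Summit.ResolutionOfSingularities.ResolutionOfSingularities.Theorems.ProximityCut
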